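import Summits.FinalStateConjecture.FinalStateConjecture.Theorems.EIHFluxBalanceLLSphereIntegrals
import Mathlib.Analysis.InnerProductSpace.Calculus
import Mathlib.Analysis.Calculus.FDeriv.Symmetric
import Literature.Geometry.Lorentzian.CoordCurvature

/-!
# Route EIHFluxBalance — `LLBalanceLaw` (iv): radial calculus and the divergence identity

Helper file for the support item `stmt-FinalStateConjecture-10189`
(`Summit.FinalStateConjecture.FinalStateConjecture.Theses.EIHFluxBalance.LLBalanceLaw`), clause (iv).
The Landau–Lifshitz balance law `dP^μ/dt = −flux` needs the vanishing of the flux of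
`Σ_l ∂_l h^{μjl}` (antisymmetric in `(j, l)`) through a CLOSED coordinate sphere, using the metric
only near the sphere. We prove it WITHOUT Stokes' theorem on the sphere, by a radial cutoff: for a
radial function `W(y) = Φ(|y − ξ|)` and an antisymmetric family `A^{jl}`,

  `Σ_l ∂_l (Σ_j ∂_j W · A^{jl}) = Σ_{j,l} ∂_j W · ∂_l A^{jl}`        (`sum_fderiv_radialGrad_mul`)

because the second derivatives of `W` are symmetric while `A` is antisymmetric; and
`∂_j W = Φ'(r) (y − ξ)_j / r` (`fderiv_comp_dist_apply_single`). Integrating the left-hand side over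
`E3` gives `0` (next file), hence `∫ Φ'(r) Σ n_j ∂_l A^{jl} dy = 0` for every radial test profile
`Φ'`, and the sphere flux vanishes by the shell formula and continuity. This file: the pointwise
calculus (chain rule through `r = |y − ξ| = √(|y − ξ|²)`, smoothness of radial functions off the
centre, a continuity-gluing helper, and the divergence identity).
-/

noncomputable section

open MeasureTheory MeasureTheory.Measure Set Function Filter Metric Module Real
open scoped Topology ENNReal InnerProductSpace

namespace Summit.FinalStateConjecture.FinalStateConjecture.Theorems

namespace LLSphere

open Literature.Geometry.Lorentzian

/-! ### Gluing continuity along a support condition -/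

/-- A function continuous on an open set containing its topological support is continuous.
[folklore] -/
theorem continuous_of_continuousOn_of_tsupport_subset {X Y : Type*} [TopologicalSpace X]
    [TopologicalSpace Y] [Zero Y] {f : X → Y} {U : Set X} (hU : IsOpen U)
    (hf : ContinuousOn f U) (hsupp : tsupport f ⊆ U) : Continuous f := by
  refine continuous_iff_continuousAt.mpr fun x ↦ ?_
  by_cases hx : x ∈ U
  · exact hf.continuousAt (hU.mem_nhds hx)
  · have hx' : x ∉ tsupport f := fun h ↦ hx (hsupp h)
    have hzero : f =ᶠ[𝓝 x] fun _ ↦ 0 := by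
      rw [notMem_tsupport_iff_eventuallyEq] at hx'
      exact hx'
    exact (continuousAt_const.congr hzero.symm)

/-- The product of a function continuous on an open set `U` with a continuous function whose
topological support lies in `U` is continuous. [folklore] -/
theorem continuous_mul_of_continuousOn {X : Type*} [TopologicalSpace X] {f g : X → ℝ}
    {U : Set X} (hU : IsOpen U) (hf : ContinuousOn f U) (hg : Continuous g)
    (hsupp : tsupport g ⊆ U) : Continuous fun x ↦ f x * g x := by
  refine continuous_of_continuousOn_of_tsupport_subset hU (hf.mul hg.continuousOn) ?_
  exact (tsupport_mul_subset_right (f := f) (g := g)).trans hsupp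

/-! ### Radial functions: chain rule through `r = |y − ξ|` -/

/-- **Gradient of a radial function**: for `Φ` differentiable at `r = |y − ξ| ≠ 0`,
`d(Φ(|· − ξ|))_y = (Φ'(r)/r) ⟨y − ξ, ·⟩` (chain rule through `r = √(|y − ξ|²)`). [folklore] -/
theorem hasFDerivAt_comp_dist {Φ : ℝ → ℝ} {ξ y : E3} (hy : y ≠ ξ)
    (hΦ : DifferentiableAt ℝ Φ (dist y ξ)) :
    HasFDerivAt (fun x : E3 ↦ Φ (dist x ξ))
      ((deriv Φ (dist y ξ) / dist y ξ) • innerSL ℝ (y - ξ)) y := by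
  have hr : 0 < dist y ξ := dist_pos.mpr hy
  have hr' : dist y ξ = ‖y - ξ‖ := dist_eq_norm y ξ
  -- `|x − ξ|²` and its derivative
  have h1 : HasFDerivAt (fun x : E3 ↦ ‖x - ξ‖ ^ 2) (2 • innerSL ℝ (y - ξ)) y := by
    have h := ((hasFDerivAt_id y).sub_const ξ).norm_sq
    simpa using h
  -- `Φ ∘ √` at `u = |y − ξ|² > 0`
  have hu : ‖y - ξ‖ ^ 2 ≠ 0 := by positivity
  have hsq : √(‖y - ξ‖ ^ 2) = dist y ξ := by rw [Real.sqrt_sq (norm_nonneg _), hr']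
  have h2 : HasDerivAt (fun u : ℝ ↦ Φ (√u)) (deriv Φ (dist y ξ) * (1 / (2 * √(‖y - ξ‖ ^ 2))))
      (‖y - ξ‖ ^ 2) := by
    have hΦ' : HasDerivAt Φ (deriv Φ (dist y ξ)) (√(‖y - ξ‖ ^ 2)) := by
      rw [hsq]
      exact hΦ.hasDerivAt
    exact hΦ'.comp _ (Real.hasDerivAt_sqrt hu)
  have h3 := h2.comp_hasFDerivAt y h1
  have hfun : (fun x : E3 ↦ Φ (dist x ξ)) = (fun u : ℝ ↦ Φ (√u)) ∘ fun x : E3 ↦ ‖x - ξ‖ ^ 2 := by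
    funext x
    simp only [Function.comp_apply, Real.sqrt_sq (norm_nonneg _), dist_eq_norm]
  rw [hfun]
  refine h3.congr_fderiv ?_
  rw [hsq]
  ext v
  simp only [FunLike.coe_smul, Pi.smul_apply, smul_eq_mul, nsmul_eq_mul, Nat.cast_ofNat,
    Pi.mul_apply, Pi.ofNat_apply]
  field_simp

/-- Coordinates of the radial gradient: `∂_j Φ(|y − ξ|) = Φ'(r) (y − ξ)_j / r`. [folklore] -/
theorem fderiv_comp_dist_apply_single {Φ : ℝ → ℝ} {ξ y : E3} (hy : y ≠ ξ)
    (hΦ : DifferentiableAt ℝ Φ (dist y ξ)) (j : Fin 3) :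
    fderiv ℝ (fun x : E3 ↦ Φ (dist x ξ)) y (EuclideanSpace.single j (1 : ℝ)) =
      deriv Φ (dist y ξ) * (y - ξ) j / dist y ξ := by
  rw [(hasFDerivAt_comp_dist hy hΦ).fderiv, FunLike.coe_smul, Pi.smul_apply,
    innerSL_apply_apply, EuclideanSpace.inner_single_right, smul_eq_mul]
  simp only [one_mul, conj_trivial]
  ring

/-- A `Cⁿ` profile gives a `Cⁿ` radial function off the centre. [folklore] -/
theorem contDiffAt_comp_dist {Φ : ℝ → ℝ} {n : WithTop ℕ∞} (hΦ : ContDiff ℝ n Φ) {ξ y : E3}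
    (hy : y ≠ ξ) : ContDiffAt ℝ n (fun x : E3 ↦ Φ (dist x ξ)) y := by
  have h : ContDiffAt ℝ n (fun x : E3 ↦ ‖x - ξ‖) y :=
    (contDiffAt_norm ℝ (sub_ne_zero.mpr hy)).comp y (contDiffAt_id.sub contDiffAt_const)
  simp_rw [dist_eq_norm]
  exact hΦ.contDiffAt.comp y h

/-! ### The divergence identity -/

/-- **Antisymmetric contraction of a symmetric second derivative vanishes**: for `W` `C²` at `y`
and `A^{jl} = −A^{lj}`, `Σ_{j,l} A^{jl} ∂_l ∂_j W (y) = 0`. [folklore] -/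
theorem sum_mul_fderiv_fderiv_eq_zero_of_antisymm {W : E3 → ℝ} {y : E3}
    (hW : ContDiffAt ℝ 2 W y) (a : Fin 3 → Fin 3 → ℝ) (hanti : ∀ j l, a j l = -a l j) :
    ∑ l : Fin 3, ∑ j : Fin 3, a j l *
      fderiv ℝ (fderiv ℝ W) y (EuclideanSpace.single l (1 : ℝ)) (EuclideanSpace.single j (1 : ℝ))
        = 0 := by
  have hsymm : ∀ v w : E3, fderiv ℝ (fderiv ℝ W) y v w = fderiv ℝ (fderiv ℝ W) y w v :=
    fun v w ↦ hW.isSymmSndFDerivAt (by simp) v w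
  set T : ℝ := ∑ l : Fin 3, ∑ j : Fin 3, a j l *
    fderiv ℝ (fderiv ℝ W) y (EuclideanSpace.single l (1 : ℝ)) (EuclideanSpace.single j (1 : ℝ))
    with hT
  have hTT : T = -T := by
    calc T = ∑ l : Fin 3, ∑ j : Fin 3, -(a l j * fderiv ℝ (fderiv ℝ W) y
          (EuclideanSpace.single j (1 : ℝ)) (EuclideanSpace.single l (1 : ℝ))) := by
            refine Finset.sum_congr rfl fun l _ ↦ Finset.sum_congr rfl fun j _ ↦ ?_
            rw [hanti j l, hsymm]
            ring
      _ = -∑ j : Fin 3, ∑ l : Fin 3, a l j * fderiv ℝ (fderiv ℝ W) y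
          (EuclideanSpace.single j (1 : ℝ)) (EuclideanSpace.single l (1 : ℝ)) := by
            rw [Finset.sum_comm]
            simp only [Finset.sum_neg_distrib]
      _ = -T := by rw [hT]
  linarith

/-- **The divergence identity.** Let `W` be `C²` at `y` and `A^{jl}` (`j, l` spatial indices) be
differentiable at `y` and antisymmetric. Then at `y`

  `Σ_l ∂_l (Σ_j ∂_j W · A^{jl}) = Σ_{j,l} ∂_j W · ∂_l A^{jl}`,

the other term `Σ_{j,l} ∂_l∂_j W · A^{jl}` vanishing (`sum_mul_fderiv_fderiv_eq_zero_of_antisymm`).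
With `W = Φ(|· − ξ|)` this is `div (Φ'(r) n · A) = Φ'(r) n_j ∂_l A^{jl}` — the radial-cutoff form
of Stokes' theorem on spheres used for the Landau–Lifshitz balance law. [folklore] -/
theorem sum_fderiv_radialGrad_mul {W : E3 → ℝ} {y : E3} (hW : ContDiffAt ℝ 2 W y)
    {A : Fin 3 → Fin 3 → E3 → ℝ} (hA : ∀ j l, DifferentiableAt ℝ (A j l) y)
    (hanti : ∀ j l x, A j l x = -A l j x) :
    ∑ l : Fin 3, fderiv ℝ (fun x : E3 ↦ ∑ j : Fin 3,
        fderiv ℝ W x (EuclideanSpace.single j (1 : ℝ)) * A j l x) y (EuclideanSpace.single l (1 : ℝ))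
      = ∑ j : Fin 3, ∑ l : Fin 3, fderiv ℝ W y (EuclideanSpace.single j (1 : ℝ)) *
          fderiv ℝ (A j l) y (EuclideanSpace.single l (1 : ℝ)) := by
  -- the partial derivatives of `W` are differentiable at `y`
  have hdW : DifferentiableAt ℝ (fderiv ℝ W) y :=
    (hW.fderiv_right (m := 1) le_rfl).differentiableAt one_ne_zero
  have hP : ∀ j : Fin 3, HasFDerivAt (fun x : E3 ↦ fderiv ℝ W x (EuclideanSpace.single j (1 : ℝ)))
      ((fderiv ℝ (fderiv ℝ W) y).flip (EuclideanSpace.single j (1 : ℝ))) y := fun j ↦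
    MetricCoord.hasFDerivAt_clm_apply_const hdW.hasFDerivAt _
  have hAd : ∀ j l, HasFDerivAt (A j l) (fderiv ℝ (A j l) y) y := fun j l ↦ (hA j l).hasFDerivAt
  -- product and sum rules
  have hB : ∀ l : Fin 3, HasFDerivAt
      (fun x : E3 ↦ ∑ j : Fin 3, fderiv ℝ W x (EuclideanSpace.single j (1 : ℝ)) * A j l x)
      (∑ j : Fin 3, (fderiv ℝ W y (EuclideanSpace.single j (1 : ℝ)) • fderiv ℝ (A j l) y +
        A j l y • (fderiv ℝ (fderiv ℝ W) y).flip (EuclideanSpace.single j (1 : ℝ)))) y :=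
    fun l ↦ HasFDerivAt.fun_sum fun j _ ↦ (hP j).mul (hAd j l)
  have happ : ∀ l : Fin 3, fderiv ℝ (fun x : E3 ↦ ∑ j : Fin 3,
      fderiv ℝ W x (EuclideanSpace.single j (1 : ℝ)) * A j l x) y (EuclideanSpace.single l (1 : ℝ))
      = ∑ j : Fin 3, (fderiv ℝ W y (EuclideanSpace.single j (1 : ℝ)) *
          fderiv ℝ (A j l) y (EuclideanSpace.single l (1 : ℝ)) + A j l y *
          fderiv ℝ (fderiv ℝ W) y (EuclideanSpace.single l (1 : ℝ))
            (EuclideanSpace.single j (1 : ℝ))) := by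
    intro l
    rw [(hB l).fderiv, _root_.sum_apply]
    refine Finset.sum_congr rfl fun j _ ↦ ?_
    simp [ContinuousLinearMap.flip_apply]
  simp_rw [happ, Finset.sum_add_distrib]
  rw [sum_mul_fderiv_fderiv_eq_zero_of_antisymm hW (fun j l ↦ A j l y) (fun j l ↦ hanti j l y),
    add_zero, Finset.sum_comm]

end LLSphere

end Summit.FinalStateConjecture.FinalStateConjecture.Theorems

end
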